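import Summits.QuantumFields.BalabanUV.Beta.GAN24.DerivativeRateTransferJensenMassFreeCoercive
import Summits.QuantumFields.BalabanUV.Beta.GAN24.DerivativeRateTransferLoewnerGramMassLattice

/-!
# `BalabanUV.Beta.GAN24.EffectiveFormLocalisationLatticeLetters` — binder row G-an2-4 ∕ (CONV-C), route R6 «VALUES, NOT DERIVATIVES», PART 108:
# THE FOUR LETTERS OF PART 105 (S2′(h)) ON THE ONE-STEP BLOCK LATTICE, FOR EVERY ORTHOGONAL BACKGROUND — the transported block-constant LIFT (`Q·lift = 1`,
# `|lift B|² = L^d|B|²`), the UPPER BOUND in trial form (`Λ = 4d·w_f′·L^d`), the FULL COERCIVITY of the regularised form `K = H_f + Qᵀ(a•1)Q`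
# («Δ_a ≥ γ_K» on ALL fields, from PART 93's kernel coercivity + the lift), and the entries ∕ block support of `Qᵀ(a•1)Q` — constants in `(d, L, |o|, a, w_f, w_f′)`
# only: volume-free AND background-free (unit b2b-balaban-gan24-p3, gen 50; v1)

NOT IN PRINT; OUR PROOF (for the ROUTE; [folklore] finite sums on PART 24's block lattice — PART 93 `coercive_lattice`, PART 97 `sum_bondDiff_sq_le_four_d_mass` ∕
`mulVec_transpose_self_of_orthogonal`, PART 24 `sum_blockWeight` BY NAME).  HONEST FRAMING (cell contract, verbatim): «discharging `BetaPertH` makes Bałaban's UV stability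
UNCONDITIONAL — a real constructive-QFT result; it is NOT the continuum limit and NOT the Clay problem.»  HONEST DEPENDENCY (verbatim): «continuum YM on T⁴ ⇐ BetaPertH ∧ nine
spine estimates (0/9 proved); BetaPertH ⇐ (D1) ∧ (D4) ∧ CAP+tail; G-an2-4 gates asym, D1 and NE2/3/4.»

THE LATTICE (PARTs 24 ∕ 64 ∕ 85 ∕ 93 ∕ 97, no `def`): coarse = unit sites `y : Fin d → ZMod M`, fine sites `x = (x.1, x.2)` (block label, position `Fin d → Fin L`), colour `o`;
orthogonal block transporters `W y x` (comb letter `hWstep` as in PART 93), orthogonal fine bond transporters `R e`, the averaging `(Qu)(y) = Σ_x [x.1 = y](L^d)⁻¹·W y x·u x`;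
a SYMMETRIC fine form `H_f` squeezed between the covariant bond energies, `w_f·Σ_e|R_eu(e⁺) − u(e⁻)|² ≤ ⟨u,H_fu⟩ ≤ w_f′·Σ_e|R_eu(e⁺) − u(e⁻)|²` (`0 < w_f`, `0 ≤ w_f′`).
WHAT THIS FILE PROVES (0 sorry, 0 `def`, nothing cited):
* §1 THE LIFT `(lift B)(x,b) = ((W x.1 x)ᵀ B(x.1))_b` (spelled inline): **`mulVec_Q_lift`** (`Q·lift B = B`), **`lift_dotProduct_self`** (`|lift B|² = L^d·|B|²`), `form_lift_le`
  (`⟨lift B, H_f lift B⟩ ≤ 4d·w_f′·L^d·|B|²`), **`ub_lattice`** — PART 105's `hUB` with `Λ = 4d·w_f′·L^d`.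
* §2 **`coercive_reg_lattice`** — «Δ_a IS COERCIVE ON ALL FIELDS»: `γ_K·|u|² ≤ ⟨u,(H_f + Qᵀ(a•1)Q)u⟩` for every `u`, `γ_K = (max (4κ) ((16dκ·w_f′·L^d + 2L^d)∕a))⁻¹`,
  `κ = 4(d(L−1))²·L^d∕w_f` (`u = z + lift(Qu)`, `z ∈ ker Q`: PART 93 on `z`, two parallelogram bounds (`form_sub_le` + inline), §1) — PART 105's `hK`.
* §3 ENTRIES: `Q_apply` (`Q (y,a) (x,b) = [x.1 = y](L^d)⁻¹·W y x a b`, from the averaging letter at `u = e_{(x,b)}`), `abs_W_apply_le_one`, **`sum_abs_Q_row_le`** (`Σ_p|Q i p| ≤ |o|`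
  — PART 105 §4's `q₁`), `Q_apply_eq_zero` (off-block entries vanish), **`abs_reg_apply_le`** (`|(Qᵀ(a•1)Q)(p,q)| ≤ a·|o|·(L^d)⁻²`, `a ≥ 0`) and **`reg_apply_eq_zero`**
  (`p.1.1 ≠ q.1.1 ⟹ (Qᵀ(a•1)Q)(p,q) = 0`).
The torus distances and the soft letter via `B4Sect5Torus.inv_decay` are the companion file `EffectiveFormLocalisationLatticeSoft` (PART 109); the plug into PART 105's ENDs is
`EffectiveFormLocalisationLatticeEnd` (PART 110).
HONEST: ONE block step (coarse = the unit lattice); background-free because at one step the block scale IS the lattice scale — nothing here is k-uniform along a tower, and nothing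
is Bałaban's `Δ_a(U)` ([B9] (3.23)); SUPPLIER work on route C-R6° (rank 2, REDUCTION); no consumer of record; NEVER «G-an2-4 closed»; NOT (CONV-C), NOT D1, NOT `BetaPertH`, NOT
continuum, NOT Clay.  Records: `HOME/b2b-balaban-gan24-p3/gen50/README.md`.
-/

noncomputable section

open Matrix Finset Function

namespace Summit.QuantumFields.BalabanUV.Beta.GAN24.EffectiveFormLocalisationLatticeLetters

open Summit.QuantumFields.BalabanUV.Beta.GAN24.DerivativeRateTransferJensenChain (self_of_orthogonal mul_transpose_of_orthogonal dotProduct_self_nonneg')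
open Summit.QuantumFields.BalabanUV.Beta.GAN24.DerivativeRateTransferJensen (dotProduct_self_eq_sum_sites)
open Summit.QuantumFields.BalabanUV.Beta.GAN24.DerivativeRateTransferJensenLattice (sum_blockWeight blockWeight_nonneg)
open Summit.QuantumFields.BalabanUV.Beta.GAN24.DerivativeRateTransferJensenMassFreeCoercive (coercive_lattice)
open Summit.QuantumFields.BalabanUV.Beta.GAN24.DerivativeRateTransferLoewnerGramMassLattice (mulVec_transpose_self_of_orthogonal sum_bondDiff_sq_le_four_d_mass)

variable {d L M : ℕ} {o : Type*} [Fintype o] [DecidableEq o]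
variable [NeZero M] [NeZero L]

/-! ## §1 The transported block-constant lift and the upper bound -/

section Lift

variable {W : (Fin d → ZMod M) → (Fin d → ZMod M) × (Fin d → Fin L) → Matrix o o ℝ}

/-- **`mulVec_Q_lift` — THE LIFT IS A RIGHT INVERSE OF THE AVERAGING**: for orthogonal block transporters and the transported block averaging `Q`, the fine field
`(lift B)(x,b) = ((W x.1 x)ᵀ B(x.1))_b` has `Q·lift B = B` (`W Wᵀ = 1`, block weights summing to one). [our proof] -/
theorem mulVec_Q_lift (hW : ∀ y x, (W y x)ᵀ * W y x = 1)
    {Q : Matrix ((Fin d → ZMod M) × o) (((Fin d → ZMod M) × (Fin d → Fin L)) × o) ℝ}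
    (hQ : ∀ (u : ((Fin d → ZMod M) × (Fin d → Fin L)) × o → ℝ) (y : Fin d → ZMod M),
      (fun a => (Q *ᵥ u) (y, a)) = ∑ x, (if x.1 = y then ((L : ℝ) ^ d)⁻¹ else 0) • (W y x *ᵥ fun b => u (x, b)))
    (B : (Fin d → ZMod M) × o → ℝ) :
    Q *ᵥ (fun p : ((Fin d → ZMod M) × (Fin d → Fin L)) × o => ((W p.1.1 p.1)ᵀ *ᵥ fun a => B (p.1.1, a)) p.2) = B := by
  funext i
  obtain ⟨y, a⟩ := i
  have h := congrFun (hQ (fun p : ((Fin d → ZMod M) × (Fin d → Fin L)) × o => ((W p.1.1 p.1)ᵀ *ᵥ fun a => B (p.1.1, a)) p.2) y) a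
  simp only at h
  rw [h]
  have hterm : ∀ x : (Fin d → ZMod M) × (Fin d → Fin L),
      (if x.1 = y then ((L : ℝ) ^ d)⁻¹ else 0) • (W y x *ᵥ fun b => ((W x.1 x)ᵀ *ᵥ fun a => B (x.1, a)) b) =
        (if x.1 = y then ((L : ℝ) ^ d)⁻¹ else 0) • (fun a => B (y, a)) := fun x => by
    by_cases hx : x.1 = y
    · have e1 : (fun b => ((W x.1 x)ᵀ *ᵥ fun a => B (x.1, a)) b) = (W y x)ᵀ *ᵥ fun a => B (y, a) := by
        funext b; rw [hx]
      rw [e1, mulVec_transpose_self_of_orthogonal (hW y x)]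
    · rw [if_neg hx, zero_smul, zero_smul]
  rw [Finset.sum_congr rfl fun x _ => hterm x, ← Finset.sum_smul, sum_blockWeight, one_smul]

omit [NeZero L] in
/-- **`lift_dotProduct_self` — THE MASS OF THE LIFT**: `|lift B|² = L^d·|B|²` (each of the `L^d` sites of block `y` carries `|Wᵀ B(y)|² = |B(y)|²`). [our proof] -/
theorem lift_dotProduct_self (hW : ∀ y x, (W y x)ᵀ * W y x = 1) (B : (Fin d → ZMod M) × o → ℝ) :
    (fun p : ((Fin d → ZMod M) × (Fin d → Fin L)) × o => ((W p.1.1 p.1)ᵀ *ᵥ fun a => B (p.1.1, a)) p.2) ⬝ᵥ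
      (fun p : ((Fin d → ZMod M) × (Fin d → Fin L)) × o => ((W p.1.1 p.1)ᵀ *ᵥ fun a => B (p.1.1, a)) p.2) = (L : ℝ) ^ d * (B ⬝ᵥ B) := by
  rw [dotProduct_self_eq_sum_sites]
  have hx : ∀ x : (Fin d → ZMod M) × (Fin d → Fin L),
      ((fun b => ((W x.1 x)ᵀ *ᵥ fun a => B (x.1, a)) b) ⬝ᵥ fun b => ((W x.1 x)ᵀ *ᵥ fun a => B (x.1, a)) b) =
        (fun a => B (x.1, a)) ⬝ᵥ fun a => B (x.1, a) := fun x => by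
    have hWt : ((W x.1 x)ᵀ)ᵀ * (W x.1 x)ᵀ = 1 := by rw [transpose_transpose]; exact mul_transpose_of_orthogonal (hW x.1 x)
    exact self_of_orthogonal hWt _
  rw [Finset.sum_congr rfl fun x _ => hx x, Fintype.sum_prod_type]
  simp only [Finset.sum_const, Finset.card_univ, Fintype.card_fun, Fintype.card_fin, nsmul_eq_mul]
  rw [dotProduct_self_eq_sum_sites B, Finset.mul_sum]
  refine Finset.sum_congr rfl fun y _ => ?_
  push_cast; ring

omit [NeZero L] in
/-- `⟨lift B, H_f lift B⟩ ≤ 4d·w_f′·L^d·|B|²` for every fine form below `w_f′·` the covariant bond energy (PART 97's crude Laplacian ceiling + `lift_dotProduct_self`). [our proof] -/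
theorem form_lift_le (hL : 0 < L) {R : ((Fin d → ZMod M) × (Fin d → Fin L)) × Fin d → Matrix o o ℝ} (hR : ∀ e, (R e)ᵀ * R e = 1)
    (hW : ∀ y x, (W y x)ᵀ * W y x = 1)
    {Hf : Matrix (((Fin d → ZMod M) × (Fin d → Fin L)) × o) (((Fin d → ZMod M) × (Fin d → Fin L)) × o) ℝ} {wf' : ℝ} (hwf' : 0 ≤ wf')
    (hHf' : ∀ u : ((Fin d → ZMod M) × (Fin d → Fin L)) × o → ℝ, u ⬝ᵥ (Hf *ᵥ u) ≤
      wf' * ∑ e : ((Fin d → ZMod M) × (Fin d → Fin L)) × Fin d,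
        ((R e *ᵥ fun b => u ((e.1.1 + ((((e.1.2 e.2 : ℕ) + 1) / L) • (Pi.single e.2 (1 : ZMod M))),
            update e.1.2 e.2 ⟨((e.1.2 e.2 : ℕ) + 1) % L, Nat.mod_lt _ hL⟩), b)) - fun b => u (e.1, b)) ⬝ᵥ
          ((R e *ᵥ fun b => u ((e.1.1 + ((((e.1.2 e.2 : ℕ) + 1) / L) • (Pi.single e.2 (1 : ZMod M))),
            update e.1.2 e.2 ⟨((e.1.2 e.2 : ℕ) + 1) % L, Nat.mod_lt _ hL⟩), b)) - fun b => u (e.1, b)))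
    (B : (Fin d → ZMod M) × o → ℝ) :
    (fun p : ((Fin d → ZMod M) × (Fin d → Fin L)) × o => ((W p.1.1 p.1)ᵀ *ᵥ fun a => B (p.1.1, a)) p.2) ⬝ᵥ
      (Hf *ᵥ fun p : ((Fin d → ZMod M) × (Fin d → Fin L)) × o => ((W p.1.1 p.1)ᵀ *ᵥ fun a => B (p.1.1, a)) p.2) ≤
      4 * d * wf' * (L : ℝ) ^ d * (B ⬝ᵥ B) := by
  have h := sum_bondDiff_sq_le_four_d_mass (M := M) hL hR
    (fun p : ((Fin d → ZMod M) × (Fin d → Fin L)) × o => ((W p.1.1 p.1)ᵀ *ᵥ fun a => B (p.1.1, a)) p.2)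
  have h3 : wf' * (4 * d * ((fun p : ((Fin d → ZMod M) × (Fin d → Fin L)) × o => ((W p.1.1 p.1)ᵀ *ᵥ fun a => B (p.1.1, a)) p.2) ⬝ᵥ
      (fun p : ((Fin d → ZMod M) × (Fin d → Fin L)) × o => ((W p.1.1 p.1)ᵀ *ᵥ fun a => B (p.1.1, a)) p.2))) =
      4 * d * wf' * (L : ℝ) ^ d * (B ⬝ᵥ B) := by
    rw [lift_dotProduct_self hW B]; ring
  rw [← h3]
  exact (hHf' _).trans (mul_le_mul_of_nonneg_left h hwf')

/-- **`ub_lattice` — THE UPPER BOUND OF THE CONSTRAINED PROBLEM IN TRIAL FORM** (PART 105's `hUB`): for every unit datum `B` the lift is admissible (`Q·lift B = B`) and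
costs `⟨lift B, H_f lift B⟩ ≤ (4d·w_f′·L^d)·|B|²` — every orthogonal background, every torus. [our proof] -/
theorem ub_lattice (hL : 0 < L) {R : ((Fin d → ZMod M) × (Fin d → Fin L)) × Fin d → Matrix o o ℝ} (hR : ∀ e, (R e)ᵀ * R e = 1)
    (hW : ∀ y x, (W y x)ᵀ * W y x = 1)
    {Q : Matrix ((Fin d → ZMod M) × o) (((Fin d → ZMod M) × (Fin d → Fin L)) × o) ℝ}
    (hQ : ∀ (u : ((Fin d → ZMod M) × (Fin d → Fin L)) × o → ℝ) (y : Fin d → ZMod M),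
      (fun a => (Q *ᵥ u) (y, a)) = ∑ x, (if x.1 = y then ((L : ℝ) ^ d)⁻¹ else 0) • (W y x *ᵥ fun b => u (x, b)))
    {Hf : Matrix (((Fin d → ZMod M) × (Fin d → Fin L)) × o) (((Fin d → ZMod M) × (Fin d → Fin L)) × o) ℝ} {wf' : ℝ} (hwf' : 0 ≤ wf')
    (hHf' : ∀ u : ((Fin d → ZMod M) × (Fin d → Fin L)) × o → ℝ, u ⬝ᵥ (Hf *ᵥ u) ≤
      wf' * ∑ e : ((Fin d → ZMod M) × (Fin d → Fin L)) × Fin d,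
        ((R e *ᵥ fun b => u ((e.1.1 + ((((e.1.2 e.2 : ℕ) + 1) / L) • (Pi.single e.2 (1 : ZMod M))),
            update e.1.2 e.2 ⟨((e.1.2 e.2 : ℕ) + 1) % L, Nat.mod_lt _ hL⟩), b)) - fun b => u (e.1, b)) ⬝ᵥ
          ((R e *ᵥ fun b => u ((e.1.1 + ((((e.1.2 e.2 : ℕ) + 1) / L) • (Pi.single e.2 (1 : ZMod M))),
            update e.1.2 e.2 ⟨((e.1.2 e.2 : ℕ) + 1) % L, Nat.mod_lt _ hL⟩), b)) - fun b => u (e.1, b))) :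
    ∀ B : (Fin d → ZMod M) × o → ℝ, ∃ u : ((Fin d → ZMod M) × (Fin d → Fin L)) × o → ℝ,
      Q *ᵥ u = B ∧ u ⬝ᵥ (Hf *ᵥ u) ≤ (4 * d * wf' * (L : ℝ) ^ d) * (B ⬝ᵥ B) :=
  fun B => ⟨_, mulVec_Q_lift hW hQ B, form_lift_le hL hR hW hwf' hHf' B⟩

end Lift

/-! ## §2 Full coercivity of the regularised form `K = H_f + Qᵀ(a•1)Q` -/

section Coercive

variable {W : (Fin d → ZMod M) → (Fin d → ZMod M) × (Fin d → Fin L) → Matrix o o ℝ}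

omit [NeZero M] [NeZero L] [DecidableEq o] in
/-- parallelogram bound for a nonnegative symmetric form: `⟨u−r, H(u−r)⟩ ≤ 2⟨u,Hu⟩ + 2⟨r,Hr⟩`. [folklore] -/
theorem form_sub_le {ι : Type*} [Fintype ι] {H : Matrix ι ι ℝ} (hH : Hᵀ = H) (hpsd : ∀ z : ι → ℝ, 0 ≤ z ⬝ᵥ (H *ᵥ z)) (u r : ι → ℝ) :
    (u - r) ⬝ᵥ (H *ᵥ (u - r)) ≤ 2 * (u ⬝ᵥ (H *ᵥ u)) + 2 * (r ⬝ᵥ (H *ᵥ r)) := by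
  have h0 := hpsd (u + r)
  have hsym : r ⬝ᵥ (H *ᵥ u) = u ⬝ᵥ (H *ᵥ r) := by
    rw [dotProduct_mulVec, dotProduct_comm, ← mulVec_transpose, hH]
  simp only [mulVec_add, dotProduct_add, add_dotProduct] at h0
  simp only [mulVec_sub, dotProduct_sub, sub_dotProduct]
  linarith

/-- **`coercive_reg_lattice` — THE REGULARISED FORM IS COERCIVE ON ALL FIELDS** («Δ_a ≥ γ_K», one block step, EVERY orthogonal background) [our proof]: with PART 93's comb
letter for `W`, orthogonal `R`, a symmetric fine form squeezed as `w_f·Σ_e|R_eu(e⁺) − u(e⁻)|² ≤ ⟨u,H_fu⟩ ≤ w_f′·Σ_e|…|²` (`0 < w_f`, `0 ≤ w_f′`) and `a > 0`: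
`γ_K·|u|² ≤ ⟨u, H_fu⟩ + a·|Qu|²` for every `u`, `γ_K⁻¹ = max (4κ) ((16dκ·w_f′·L^d + 2L^d)∕a)`, `κ = 4(d(L−1))²·L^d∕w_f`.  Mechanism: `u = z + lift(Qu)`, `Qz = 0`;
`|z|² ≤ κ⟨z,H_fz⟩` (PART 93); `⟨z,H_fz⟩ ≤ 2⟨u,H_fu⟩ + 2⟨lift,H_f lift⟩ ≤ 2⟨u,H_fu⟩ + 8dw_f′L^d|Qu|²`; `|u|² ≤ 2|z|² + 2L^d|Qu|²`. -/
theorem coercive_reg_lattice (hL : 0 < L) {R : ((Fin d → ZMod M) × (Fin d → Fin L)) × Fin d → Matrix o o ℝ} (hR : ∀ e, (R e)ᵀ * R e = 1)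
    (hW : ∀ y x, (W y x)ᵀ * W y x = 1)
    (hWstep : ∀ (y : Fin d → ZMod M) (z : Fin d → Fin L) (μ : Fin d) (h : (z μ : ℕ) + 1 < L), (∀ ν, μ < ν → (z ν : ℕ) = 0) →
      W y (y, update z μ ⟨(z μ : ℕ) + 1, h⟩) = W y (y, z) * R ((y, z), μ))
    {Q : Matrix ((Fin d → ZMod M) × o) (((Fin d → ZMod M) × (Fin d → Fin L)) × o) ℝ}
    (hQ : ∀ (u : ((Fin d → ZMod M) × (Fin d → Fin L)) × o → ℝ) (y : Fin d → ZMod M),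
      (fun a => (Q *ᵥ u) (y, a)) = ∑ x, (if x.1 = y then ((L : ℝ) ^ d)⁻¹ else 0) • (W y x *ᵥ fun b => u (x, b)))
    {Hf : Matrix (((Fin d → ZMod M) × (Fin d → Fin L)) × o) (((Fin d → ZMod M) × (Fin d → Fin L)) × o) ℝ} (hHsym : Hfᵀ = Hf)
    {wf wf' : ℝ} (hwf : 0 < wf) (hwf' : 0 ≤ wf')
    (hHf : ∀ u : ((Fin d → ZMod M) × (Fin d → Fin L)) × o → ℝ,
      wf * ∑ e : ((Fin d → ZMod M) × (Fin d → Fin L)) × Fin d,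
        ((R e *ᵥ fun b => u ((e.1.1 + ((((e.1.2 e.2 : ℕ) + 1) / L) • (Pi.single e.2 (1 : ZMod M))),
            update e.1.2 e.2 ⟨((e.1.2 e.2 : ℕ) + 1) % L, Nat.mod_lt _ hL⟩), b)) - fun b => u (e.1, b)) ⬝ᵥ
          ((R e *ᵥ fun b => u ((e.1.1 + ((((e.1.2 e.2 : ℕ) + 1) / L) • (Pi.single e.2 (1 : ZMod M))),
            update e.1.2 e.2 ⟨((e.1.2 e.2 : ℕ) + 1) % L, Nat.mod_lt _ hL⟩), b)) - fun b => u (e.1, b)) ≤ u ⬝ᵥ (Hf *ᵥ u))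
    (hHf' : ∀ u : ((Fin d → ZMod M) × (Fin d → Fin L)) × o → ℝ, u ⬝ᵥ (Hf *ᵥ u) ≤
      wf' * ∑ e : ((Fin d → ZMod M) × (Fin d → Fin L)) × Fin d,
        ((R e *ᵥ fun b => u ((e.1.1 + ((((e.1.2 e.2 : ℕ) + 1) / L) • (Pi.single e.2 (1 : ZMod M))),
            update e.1.2 e.2 ⟨((e.1.2 e.2 : ℕ) + 1) % L, Nat.mod_lt _ hL⟩), b)) - fun b => u (e.1, b)) ⬝ᵥ
          ((R e *ᵥ fun b => u ((e.1.1 + ((((e.1.2 e.2 : ℕ) + 1) / L) • (Pi.single e.2 (1 : ZMod M))),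
            update e.1.2 e.2 ⟨((e.1.2 e.2 : ℕ) + 1) % L, Nat.mod_lt _ hL⟩), b)) - fun b => u (e.1, b)))
    {a : ℝ} (ha : 0 < a) (u : ((Fin d → ZMod M) × (Fin d → Fin L)) × o → ℝ) :
    (max (4 * (4 * (d * ((L : ℝ) - 1)) ^ 2 * (L : ℝ) ^ d / wf))
        ((16 * d * (4 * (d * ((L : ℝ) - 1)) ^ 2 * (L : ℝ) ^ d / wf) * wf' * (L : ℝ) ^ d + 2 * (L : ℝ) ^ d) / a))⁻¹ * (u ⬝ᵥ u) ≤
      u ⬝ᵥ (Hf *ᵥ u) + a * ((Q *ᵥ u) ⬝ᵥ (Q *ᵥ u)) := by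
  set κ : ℝ := 4 * (d * ((L : ℝ) - 1)) ^ 2 * (L : ℝ) ^ d / wf with hκ
  set C : ℝ := max (4 * κ) ((16 * d * κ * wf' * (L : ℝ) ^ d + 2 * (L : ℝ) ^ d) / a) with hC
  set B : (Fin d → ZMod M) × o → ℝ := Q *ᵥ u with hB
  set r : ((Fin d → ZMod M) × (Fin d → Fin L)) × o → ℝ :=
    fun p => ((W p.1.1 p.1)ᵀ *ᵥ fun a => B (p.1.1, a)) p.2 with hr
  set z : ((Fin d → ZMod M) × (Fin d → Fin L)) × o → ℝ := u - r with hz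
  have hLd : 0 < (L : ℝ) ^ d := pow_pos (Nat.cast_pos.mpr hL) d
  have hκ0 : 0 ≤ κ := by rw [hκ]; positivity
  -- nonnegativity of the form (from the lower squeeze)
  have hpsd : ∀ v : ((Fin d → ZMod M) × (Fin d → Fin L)) × o → ℝ, 0 ≤ v ⬝ᵥ (Hf *ᵥ v) := fun v =>
    (mul_nonneg hwf.le (Finset.sum_nonneg fun e _ => dotProduct_self_nonneg' _)).trans (hHf v)
  -- `z ∈ ker Q`
  have hQr : Q *ᵥ r = B := mulVec_Q_lift hW hQ B
  have hQz : Q *ᵥ z = 0 := by rw [hz, mulVec_sub, hQr, hB, sub_self]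
  -- PART 93 on `z`: `|z|² ≤ κ·⟨z, H_f z⟩`
  have h93 := coercive_lattice hL hW hWstep hQ hwf.le hHf z hQz
  have hzz : z ⬝ᵥ z ≤ κ * (z ⬝ᵥ (Hf *ᵥ z)) := by
    have hc0 : 0 < ((L : ℝ) ^ d)⁻¹ * wf := mul_pos (inv_pos.mpr hLd) hwf
    rw [hκ]
    have e : 4 * (d * ((L : ℝ) - 1)) ^ 2 * (L : ℝ) ^ d / wf * (z ⬝ᵥ (Hf *ᵥ z)) =
        (4 * (d * ((L : ℝ) - 1)) ^ 2 * (z ⬝ᵥ (Hf *ᵥ z))) / (((L : ℝ) ^ d)⁻¹ * wf) := by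
      field_simp
    rw [e, le_div_iff₀ hc0]
    linarith
  -- the lift's letters
  have hrH : r ⬝ᵥ (Hf *ᵥ r) ≤ 4 * d * wf' * (L : ℝ) ^ d * (B ⬝ᵥ B) := form_lift_le hL hR hW hwf' hHf' B
  have hrr : r ⬝ᵥ r = (L : ℝ) ^ d * (B ⬝ᵥ B) := lift_dotProduct_self hW B
  -- parallelograms
  have hzH : z ⬝ᵥ (Hf *ᵥ z) ≤ 2 * (u ⬝ᵥ (Hf *ᵥ u)) + 2 * (r ⬝ᵥ (Hf *ᵥ r)) := form_sub_le hHsym hpsd u r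
  have huu : u ⬝ᵥ u ≤ 2 * (z ⬝ᵥ z) + 2 * (r ⬝ᵥ r) := by
    -- parallelogram for the mass: `|z + r|² ≤ 2|z|² + 2|r|²` with `z + r = u`
    have h0 : 0 ≤ (z - r) ⬝ᵥ (z - r) := dotProduct_self_nonneg' _
    have e : u = z + r := by rw [hz, sub_add_cancel]
    simp only [dotProduct_sub, sub_dotProduct] at h0
    rw [e]
    simp only [dotProduct_add, add_dotProduct]
    have hc : z ⬝ᵥ r = r ⬝ᵥ z := dotProduct_comm z r
    linarith
  have hBB : 0 ≤ B ⬝ᵥ B := dotProduct_self_nonneg' _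
  have huH : 0 ≤ u ⬝ᵥ (Hf *ᵥ u) := hpsd u
  -- assembly: `|u|² ≤ 4κ⟨u,Hu⟩ + (16dκ w_f′ L^d + 2L^d)|B|² ≤ C·(⟨u,Hu⟩ + a|B|²)`
  have hmain : u ⬝ᵥ u ≤ 4 * κ * (u ⬝ᵥ (Hf *ᵥ u)) + (16 * d * κ * wf' * (L : ℝ) ^ d + 2 * (L : ℝ) ^ d) * (B ⬝ᵥ B) := by
    have h1 : z ⬝ᵥ z ≤ κ * (2 * (u ⬝ᵥ (Hf *ᵥ u)) + 2 * (4 * d * wf' * (L : ℝ) ^ d * (B ⬝ᵥ B))) :=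
      hzz.trans (mul_le_mul_of_nonneg_left (by linarith) hκ0)
    rw [hrr] at huu
    nlinarith
  have hC1 : 4 * κ ≤ C := le_max_left _ _
  have hC2 : (16 * d * κ * wf' * (L : ℝ) ^ d + 2 * (L : ℝ) ^ d) / a ≤ C := le_max_right _ _
  have hC2' : 16 * d * κ * wf' * (L : ℝ) ^ d + 2 * (L : ℝ) ^ d ≤ C * a := by rwa [div_le_iff₀ ha] at hC2
  have hCpos : 0 < C := lt_of_lt_of_le (by positivity : 0 < (16 * d * κ * wf' * (L : ℝ) ^ d + 2 * (L : ℝ) ^ d) / a) hC2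
  have hfin : u ⬝ᵥ u ≤ C * (u ⬝ᵥ (Hf *ᵥ u) + a * (B ⬝ᵥ B)) := by
    calc u ⬝ᵥ u ≤ 4 * κ * (u ⬝ᵥ (Hf *ᵥ u)) + (16 * d * κ * wf' * (L : ℝ) ^ d + 2 * (L : ℝ) ^ d) * (B ⬝ᵥ B) := hmain
      _ ≤ C * (u ⬝ᵥ (Hf *ᵥ u)) + (C * a) * (B ⬝ᵥ B) := add_le_add (mul_le_mul_of_nonneg_right hC1 huH) (mul_le_mul_of_nonneg_right hC2' hBB)
      _ = C * (u ⬝ᵥ (Hf *ᵥ u) + a * (B ⬝ᵥ B)) := by ring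
  rw [inv_mul_le_iff₀ hCpos]
  exact hfin

end Coercive

/-! ## §3 Entries: the averaging, its row mass, and the regularisation `Qᵀ(a•1)Q` -/

section Entries

variable {W : (Fin d → ZMod M) → (Fin d → ZMod M) × (Fin d → Fin L) → Matrix o o ℝ}
variable {Q : Matrix ((Fin d → ZMod M) × o) (((Fin d → ZMod M) × (Fin d → Fin L)) × o) ℝ}

omit [NeZero L] in
/-- **`Q_apply` — THE ENTRIES OF THE AVERAGING**: the averaging letter at the unit source `u = e_{(x,b)}` gives `Q (y,a) (x,b) = [x.1 = y]·(L^d)⁻¹·W y x a b`. [our proof] -/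
theorem Q_apply
    (hQ : ∀ (u : ((Fin d → ZMod M) × (Fin d → Fin L)) × o → ℝ) (y : Fin d → ZMod M),
      (fun a => (Q *ᵥ u) (y, a)) = ∑ x, (if x.1 = y then ((L : ℝ) ^ d)⁻¹ else 0) • (W y x *ᵥ fun b => u (x, b)))
    (y : Fin d → ZMod M) (a : o) (x : (Fin d → ZMod M) × (Fin d → Fin L)) (b : o) :
    Q (y, a) (x, b) = (if x.1 = y then ((L : ℝ) ^ d)⁻¹ else 0) * W y x a b := by
  have h := congrFun (hQ (Pi.single (x, b) 1) y) a
  have key : (Q *ᵥ Pi.single (x, b) (1 : ℝ)) (y, a) = Q (y, a) (x, b) := by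
    simp only [Matrix.mulVec, dotProduct_single, mul_one]
  simp only [key] at h
  rw [h, Finset.sum_apply]
  simp only [Pi.smul_apply, smul_eq_mul]
  have hterm : ∀ x' : (Fin d → ZMod M) × (Fin d → Fin L),
      (if x'.1 = y then ((L : ℝ) ^ d)⁻¹ else 0) * (W y x' *ᵥ fun b' => (Pi.single (x, b) (1 : ℝ) : _ → ℝ) (x', b')) a =
        if x' = x then (if x.1 = y then ((L : ℝ) ^ d)⁻¹ else 0) * W y x a b else 0 := fun x' => by
    by_cases hx : x' = x
    · subst hx
      rw [if_pos rfl]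
      congr 1
      have e : (fun b' => (Pi.single (x', b) (1 : ℝ) : _ → ℝ) (x', b')) = Pi.single b 1 := by
        funext b'
        by_cases hb : b' = b
        · subst hb; simp
        · rw [Pi.single_eq_of_ne (fun h => hb (Prod.ext_iff.mp h).2), Pi.single_eq_of_ne hb]
      rw [e]
      simp only [Matrix.mulVec, dotProduct_single, mul_one]
    · rw [if_neg hx]
      have e : (fun b' => (Pi.single (x, b) (1 : ℝ) : _ → ℝ) (x', b')) = 0 := by
        funext b'
        rw [Pi.single_eq_of_ne (fun h => hx (Prod.ext_iff.mp h).1)]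
        rfl
      rw [e, mulVec_zero, Pi.zero_apply, mul_zero]
  rw [Finset.sum_congr rfl fun x' _ => hterm x', Finset.sum_ite_eq' Finset.univ x, if_pos (Finset.mem_univ _)]

omit [NeZero M] [NeZero L] in
/-- entries of an orthogonal matrix are at most one in absolute value (`Σ_a W a b² = 1`). [folklore] -/
theorem abs_W_apply_le_one {V : Matrix o o ℝ} (hV : Vᵀ * V = 1) (a b : o) : |V a b| ≤ 1 := by
  have h : ∑ a', V a' b * V a' b = 1 := by
    have := congrFun (congrFun hV b) b
    rwa [Matrix.mul_apply, Matrix.one_apply_eq] at this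
  have hle : V a b * V a b ≤ 1 := by
    rw [← h]
    exact Finset.single_le_sum (f := fun a' => V a' b * V a' b) (fun a' _ => mul_self_nonneg _) (Finset.mem_univ a)
  have : |V a b| * |V a b| ≤ 1 := by rw [← abs_mul, abs_of_nonneg (mul_self_nonneg _)]; exact hle
  nlinarith [abs_nonneg (V a b)]

/-- **`sum_abs_Q_row_le` — THE ROW MASS OF THE AVERAGING** (PART 105 §4's `q₁`): `Σ_p |Q i p| ≤ |o|` for orthogonal `W`. [our proof] -/
theorem sum_abs_Q_row_le (hW : ∀ y x, (W y x)ᵀ * W y x = 1)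
    (hQ : ∀ (u : ((Fin d → ZMod M) × (Fin d → Fin L)) × o → ℝ) (y : Fin d → ZMod M),
      (fun a => (Q *ᵥ u) (y, a)) = ∑ x, (if x.1 = y then ((L : ℝ) ^ d)⁻¹ else 0) • (W y x *ᵥ fun b => u (x, b)))
    (i : (Fin d → ZMod M) × o) : ∑ p, |Q i p| ≤ Fintype.card o := by
  obtain ⟨y, a⟩ := i
  calc ∑ p : ((Fin d → ZMod M) × (Fin d → Fin L)) × o, |Q (y, a) p|
      = ∑ x : (Fin d → ZMod M) × (Fin d → Fin L), ∑ b : o, |Q (y, a) (x, b)| := Fintype.sum_prod_type _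
    _ ≤ ∑ x : (Fin d → ZMod M) × (Fin d → Fin L), ∑ _b : o, (if x.1 = y then ((L : ℝ) ^ d)⁻¹ else 0) :=
        Finset.sum_le_sum fun x _ => Finset.sum_le_sum fun b _ => by
          rw [Q_apply hQ y a x b, abs_mul, abs_of_nonneg (blockWeight_nonneg y x)]
          exact (mul_le_mul_of_nonneg_left (abs_W_apply_le_one (hW y x) a b) (blockWeight_nonneg y x)).trans (le_of_eq (mul_one _))
    _ = Fintype.card o * ∑ x : (Fin d → ZMod M) × (Fin d → Fin L), (if x.1 = y then ((L : ℝ) ^ d)⁻¹ else 0) := by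
        rw [Finset.mul_sum]
        refine Finset.sum_congr rfl fun x _ => ?_
        rw [Finset.sum_const, Finset.card_univ, nsmul_eq_mul]
    _ = Fintype.card o := by rw [sum_blockWeight, mul_one]

omit [NeZero L] in
/-- off-block entries of the averaging vanish: `x.1 ≠ y ⟹ Q (y,a) (x,b) = 0`. [our proof] -/
theorem Q_apply_eq_zero
    (hQ : ∀ (u : ((Fin d → ZMod M) × (Fin d → Fin L)) × o → ℝ) (y : Fin d → ZMod M),
      (fun a => (Q *ᵥ u) (y, a)) = ∑ x, (if x.1 = y then ((L : ℝ) ^ d)⁻¹ else 0) • (W y x *ᵥ fun b => u (x, b)))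
    {y : Fin d → ZMod M} {x : (Fin d → ZMod M) × (Fin d → Fin L)} (hxy : x.1 ≠ y) (a b : o) : Q (y, a) (x, b) = 0 := by
  rw [Q_apply hQ, if_neg hxy, zero_mul]

omit [NeZero L] in
/-- **`abs_reg_apply_le` — THE ENTRIES OF THE REGULARISATION**: `|(Qᵀ(a•1)Q)(p,q)| ≤ a·|o|·(L^d)⁻²` (`a ≥ 0`; each of the `|o|` unit indices over the common block
contributes `(L^d)⁻²·|W||W| ≤ (L^d)⁻²`). [our proof] -/
theorem abs_reg_apply_le (hW : ∀ y x, (W y x)ᵀ * W y x = 1)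
    (hQ : ∀ (u : ((Fin d → ZMod M) × (Fin d → Fin L)) × o → ℝ) (y : Fin d → ZMod M),
      (fun a => (Q *ᵥ u) (y, a)) = ∑ x, (if x.1 = y then ((L : ℝ) ^ d)⁻¹ else 0) • (W y x *ᵥ fun b => u (x, b)))
    {a : ℝ} (ha : 0 ≤ a) (p q : ((Fin d → ZMod M) × (Fin d → Fin L)) × o) :
    |(Qᵀ * (a • (1 : Matrix ((Fin d → ZMod M) × o) ((Fin d → ZMod M) × o) ℝ)) * Q) p q| ≤ a * Fintype.card o * (((L : ℝ) ^ d)⁻¹) ^ 2 := by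
  rw [Matrix.mul_smul, Matrix.mul_one, Matrix.smul_mul, Matrix.smul_apply, smul_eq_mul, abs_mul, abs_of_nonneg ha, mul_assoc]
  refine mul_le_mul_of_nonneg_left ?_ ha
  rw [Matrix.mul_apply]
  have hLd : 0 ≤ ((L : ℝ) ^ d)⁻¹ := by positivity
  have hent : ∀ i : (Fin d → ZMod M) × o, |Q i p| ≤ ((L : ℝ) ^ d)⁻¹ ∧ |Q i q| ≤ ((L : ℝ) ^ d)⁻¹ := fun i => by
    obtain ⟨y, a'⟩ := i
    obtain ⟨x, b⟩ := p
    obtain ⟨x', b'⟩ := q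
    refine ⟨?_, ?_⟩
    · rw [Q_apply hQ, abs_mul, abs_of_nonneg (blockWeight_nonneg y x)]
      refine (mul_le_mul_of_nonneg_left (abs_W_apply_le_one (hW y x) a' b) (blockWeight_nonneg y x)).trans ?_
      rw [mul_one]; split_ifs
      · exact le_rfl
      · exact hLd
    · rw [Q_apply hQ, abs_mul, abs_of_nonneg (blockWeight_nonneg y x')]
      refine (mul_le_mul_of_nonneg_left (abs_W_apply_le_one (hW y x') a' b') (blockWeight_nonneg y x')).trans ?_
      rw [mul_one]; split_ifs
      · exact le_rfl
      · exact hLd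
  -- only the unit indices over the block of `p` contribute; bound every term over `{y = p.1.1} × o` by `(L^d)⁻²` and the rest by `0`
  calc |∑ i, Qᵀ p i * Q i q| ≤ ∑ i, |Qᵀ p i * Q i q| := Finset.abs_sum_le_sum_abs _ _
    _ ≤ ∑ i : (Fin d → ZMod M) × o, (if i.1 = p.1.1 then (((L : ℝ) ^ d)⁻¹) ^ 2 else 0) :=
        Finset.sum_le_sum fun i _ => by
          rw [transpose_apply, abs_mul]
          by_cases hi : i.1 = p.1.1
          · rw [if_pos hi, pow_two]
            exact mul_le_mul (hent i).1 (hent i).2 (abs_nonneg _) hLd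
          · rw [if_neg hi]
            obtain ⟨y, a'⟩ := i
            obtain ⟨x, b⟩ := p
            rw [Q_apply_eq_zero hQ (fun h => hi h.symm) a' b, abs_zero, zero_mul]
    _ = Fintype.card o * (((L : ℝ) ^ d)⁻¹) ^ 2 := by
        rw [Fintype.sum_prod_type]
        dsimp only
        rw [Finset.sum_comm]
        simp only [Finset.sum_ite_eq', Finset.mem_univ, if_true, Finset.sum_const, Finset.card_univ, nsmul_eq_mul]

omit [NeZero L] in
/-- **`reg_apply_eq_zero` — THE REGULARISATION IS BLOCK-DIAGONAL**: `p.1.1 ≠ q.1.1 ⟹ (Qᵀ(a•1)Q)(p,q) = 0`. [our proof] -/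
theorem reg_apply_eq_zero
    (hQ : ∀ (u : ((Fin d → ZMod M) × (Fin d → Fin L)) × o → ℝ) (y : Fin d → ZMod M),
      (fun a => (Q *ᵥ u) (y, a)) = ∑ x, (if x.1 = y then ((L : ℝ) ^ d)⁻¹ else 0) • (W y x *ᵥ fun b => u (x, b)))
    (a : ℝ) {p q : ((Fin d → ZMod M) × (Fin d → Fin L)) × o} (hpq : p.1.1 ≠ q.1.1) :
    (Qᵀ * (a • (1 : Matrix ((Fin d → ZMod M) × o) ((Fin d → ZMod M) × o) ℝ)) * Q) p q = 0 := by
  rw [Matrix.mul_smul, Matrix.mul_one, Matrix.smul_mul, Matrix.smul_apply, smul_eq_mul, Matrix.mul_apply]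
  have hsum : ∑ i : (Fin d → ZMod M) × o, Qᵀ p i * Q i q = 0 := by
    refine Finset.sum_eq_zero fun i _ => ?_
    obtain ⟨y, a'⟩ := i
    rw [transpose_apply]
    by_cases hy : p.1.1 = y
    · have hy' : q.1.1 ≠ y := fun h => hpq (hy.trans h.symm)
      have hq : Q (y, a') q = 0 := by
        obtain ⟨x', b'⟩ := q
        exact Q_apply_eq_zero hQ hy' a' b'
      rw [hq, mul_zero]
    · have hp : Q (y, a') p = 0 := by
        obtain ⟨x, b⟩ := p
        exact Q_apply_eq_zero hQ hy a' b
      rw [hp, zero_mul]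
  rw [hsum, mul_zero]

end Entries

end Summit.QuantumFields.BalabanUV.Beta.GAN24.EffectiveFormLocalisationLatticeLetters

end
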